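import Mathlib
import Summits.KontsevichZagierPeriods.Zeta5Search.BrickDenominators

/-!
# BrickLucasAssembly — the LUCAS CONGRUENCE for the leading coefficients of the very-well-poised brick linear forms,
`x_{A−1}(n₀ + Np) ≡ x_{A−1}(n₀)·x_{A−1}(N) (mod p)`, REDUCED to two digit-block laws of the depth-one Dwork data
(cell zeta5-irr)

HONEST FRAMING: systematic search; no irrationality claim unless certified. INSTRUMENT-tier arithmetic of the ζ(5)
census cell zeta5-irr (HOME `run/shared/lean/pub/zeta5-irr/`), filed by the engine seat zi-eng (g13); numeric lead
`zi-eng/lean-g12/FINDINGS-g12.md` §4 (kit j287948: 0 failures / 348 rows, 0 / 1116 blocks). WHAT THIS IS NOT: nothing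
about ζ(5); no denominator saving; 0 nats/n; rung F-Z1 NOT moved. This file is the ASSEMBLY: it proves the Lucas
congruence for the row `n = n₀ + Np` of the kernel `(A,B,1)` (every odd prime `p`, `A` even, `1 ≤ B ≤ A/2`, every
level) FROM two laws (V), (W) of the depth-one block data, stated as hypotheses; the sequel files discharge (V), (W).

## Objects (all from the chain; `v = Rat.padicValuation p`, `c = BrickLaurent.cell`, `c̃` = the `ε = 0` cells)

Row `n = n₀ + Np` (`n₀ < p`), ° cell `k = k₀ + Kp` (`k₀ ≤ n₀`, `K ≤ N`), multiplier `λ_k = c_{k,A}(n)/c̃_{K,A}(N)`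
(`cTop … / cTop …`, as in `BrickLevelReduction.blockWeight`), leading coefficient `x(n) := x_{A−1}(n) = Σ_k c_{k,A−1}(n)`
(`BrickPartialFractions.xCoeff … (A−1)`; `c_{k,A−1} = laurent … k 1`).
* `stripDeriv` — THE STRIP DERIVATIVE `w₁(k) := (p·c_{k,A−1}(n) − λ_k·c̃_{K,A−1}(N)) / c̃_{K,A}(N)`, i.e. the depth-one
  two-scale identity `p·c_{k,A−1}(n) = λ_k·c̃_{K,A−1}(N) + w₁(k)·c̃_{K,A}(N)` holds BY DEFINITION (`cell_depth_one_eq`); in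
  the chain's factorisation `F_k(pT) = a·F̃_K(T)·E_k(T)·U_k(T)` (`BrickDigitStripCirc`) it is `w₁(k) = a·[T¹](E_k U_k)`.
* `stripSum` — `V(K) := Σ_{k₀ ≤ n₀} w₁(k₀ + Kp)`; `W(K) := blockWeight … (g ≡ 1) K = Σ_{k₀ ≤ n₀} λ_{k₀+Kp}`.

## The statement (`lucas_of_blockLaws`)

For an odd prime `p`, `A` even, `1 ≤ B`, `2B ≤ A`, `n₀ < p`, `N < p^{L+1}`: IF
(V) `v(V(K) − p·x(n₀)) ≤ exp(−2)` for every `K ≤ N`, and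
(W) `v(W(K') − W(K) + (K' − K)·p·x(n₀)) ≤ exp(−(e+2))` for all `K, K' ≤ N` and every `e` with `p^e ∣ K − K'`,
THEN **`v(x(n₀ + Np) − x(n₀)·x(N)) ≤ exp(−1)`**, i.e. `x_{A−1}(n₀ + Np) ≡ x_{A−1}(n₀)·x_{A−1}(N) (mod p)`
(`x_{A−1} ∈ ℤ_(p)` by `BrickDenominators.padicValuation_xCoeff_le`).

PROOF (level `L+1`, normalisation `p^{L+1}`): split `p^{L+1}x(n) = Σ_{° cells} + Σ_{hole cells}`. The ° part is
EXACTLY `Σ_K W(K)·p^L c̃_{K,A−1}(N) + Σ_K V(K)·p^L c̃_{K,A}(N)` (`block_depth_one_eq`); the target is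
`p^{L+1}x(n₀)x(N) = p·x(n₀)·Σ_K p^L[(N/2 − K)c̃_{K,A−1}(N) + c̃_{K,A}(N)]` (`BrickLaurentValuation.laurent_succ_succ`). The
`V`-difference is `≤ exp(−(L+2))` termwise by (V) (`c̃_{K,A}(N) ∈ ℤ`); the `W`-difference is `Σ_K D(K)·p^L c̃_{K,A−1}(N)`
with `D(K) = W(K) − p·x(n₀)(N/2 − K)`, and `D/p²` is an ADMISSIBLE weight for the row `N` at level `L` ((I) from (W) at
`e = 0` and the exact antisymmetry `W(N−K) = −W(K)`, `p` odd; (S) from `BrickBlockWeight.blockWeight_reflect_add_le`;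
(D) = (W)), so zi-p2's PROPOSITION H^∞ (`BrickPropositionHInf.propositionH_inf`) gives `≤ exp(−(L+2))`. The hole part is
`≤ exp(−(A+L)) ≤ exp(−(L+2))` (`BrickLevelReductionInf.hole_cell_le` at depth `1`, the hole weight `G = p^A·γ` with `γ`
admissible, `BrickHoleWeight`, H^∞ again; the exact-centre hole cell by `laurent_centre` + Lucas' `p ∣ C(n,k)`).
-/

namespace Summit.KontsevichZagierPeriods.Zeta5Search.BrickLucasAssembly

open Finset Nat WithZero
open Summit.KontsevichZagierPeriods.Zeta5Search.BrickTopCoefficient (cTop)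
open Summit.KontsevichZagierPeriods.Zeta5Search.BrickLaurent (laurent cell laurent_zero)
open Summit.KontsevichZagierPeriods.Zeta5Search.BrickLaurentValuation (padicValuation_natCast laurent_succ_succ
  laurent_centre)
open Summit.KontsevichZagierPeriods.Zeta5Search.BrickPartialFractions (xCoeff)
open Summit.KontsevichZagierPeriods.Zeta5Search.BrickLambda (cTop_zero_ne_zero padicValuation_two)
open Summit.KontsevichZagierPeriods.Zeta5Search.BrickLambdaCirc (padicValuation_cTop_eq exp_neg_natCast)
open Summit.KontsevichZagierPeriods.Zeta5Search.BrickTopKummer (padicValuation_natCast_le_exp_neg cell_one_valuation_abs)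
open Summit.KontsevichZagierPeriods.Zeta5Search.BrickHoleCells (one_le_padicValNat_choose_of_mod_lt)
open Summit.KontsevichZagierPeriods.Zeta5Search.BrickLevelReduction (blockWeight cTop_one_centre sum_range_digit_split
  row_lt)
open Summit.KontsevichZagierPeriods.Zeta5Search.BrickBlockWeight (padicValuation_cTop_le_one blockWeight_reflect_add_le)
open Summit.KontsevichZagierPeriods.Zeta5Search.BrickHoleWeight (holeWeight holeWeight_le holeWeight_reflect_add_le
  holeWeight_local)
open Summit.KontsevichZagierPeriods.Zeta5Search.BrickLevelReductionInf (hole_cell_le)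
open Summit.KontsevichZagierPeriods.Zeta5Search.BrickPropositionHInf (padicValuation_div_pow_le propositionH_inf)
open Literature.NumberTheory.LFunctions (padicValuation_natCast_le_one)

noncomputable section

variable {p : ℕ} [Fact p.Prime]

/-! ## The depth-one block data -/

/-- **The strip derivative** `w₁(k)` of the ° cell `k = k₀ + Kp` of the row `n = n₀ + Np` (kernel `ε`):
`w₁(k) := (p·c_{k,A−1}(n) − λ_k·c̃_{K,A−1}(N)) / c̃_{K,A}(N)`, `λ_k = c_{k,A}(n)/c̃_{K,A}(N)` — the first Taylor coefficient
`a·[T¹](E_k U_k)` of the chain's two-scale factor, DEFINED through the depth-one identity it satisfies. -/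
def stripDeriv (A B ε p n₀ N k₀ K : ℕ) : ℚ :=
  ((p : ℚ) * laurent A B ε (n₀ + N * p) (k₀ + K * p) 1 -
      cTop A B ε (n₀ + N * p) (k₀ + K * p) / cTop A B 0 N K * laurent A B 0 N K 1) / cTop A B 0 N K

/-- **The strip sum** `V(K) := Σ_{k₀ ≤ n₀} w₁(k₀ + Kp)` of the digit block `K` (the companion of the ° block weight
`W(K) = Σ_{k₀ ≤ n₀} λ_{k₀+Kp}` = `blockWeight … (g ≡ 1) K`). -/
def stripSum (A B ε p n₀ N K : ℕ) : ℚ := ∑ k₀ ∈ range (n₀ + 1), stripDeriv A B ε p n₀ N k₀ K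

/-- **The leading coefficient** `x(n) := x_{A−1}(n) = Σ_{k ≤ n} c_{k,A−1}(n)` of the very-well-poised kernel
`(A,B,1)` (`BrickPartialFractions.xCoeff … (A−1)`; for `(6,1,1)` Zudilin's `uₙ`, for `(4,1,1)` the Apéry numbers `bₙ`,
`BrickLinearForms` / `BrickBallApery`). -/
def xLead (A B n : ℕ) : ℚ := xCoeff A B 1 n (A - 1)

omit [Fact p.Prime] in
/-- **The depth-one two-scale identity, cell by cell** (`K ≤ N`):
`p·c_{k,A−1}(n) = λ_k·c̃_{K,A−1}(N) + w₁(k)·c̃_{K,A}(N)` (by the definition of `w₁`). -/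
theorem cell_depth_one_eq (A B ε n₀ : ℕ) {N K : ℕ} (hK : K ≤ N) (k₀ : ℕ) :
    (p : ℚ) * laurent A B ε (n₀ + N * p) (k₀ + K * p) 1 =
      cTop A B ε (n₀ + N * p) (k₀ + K * p) / cTop A B 0 N K * laurent A B 0 N K 1 +
        stripDeriv A B ε p n₀ N k₀ K * cTop A B 0 N K := by
  have h0 := cTop_zero_ne_zero hK A B
  unfold stripDeriv
  field_simp
  ring

omit [Fact p.Prime] in
/-- **The depth-one identity, block by block** (`K ≤ N`):
`Σ_{k₀ ≤ n₀} p·c_{k₀+Kp,A−1}(n) = W(K)·c̃_{K,A−1}(N) + V(K)·c̃_{K,A}(N)`. -/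
theorem block_depth_one_eq (A B ε n₀ : ℕ) {N K : ℕ} (hK : K ≤ N) :
    ∑ k₀ ∈ range (n₀ + 1), (p : ℚ) * laurent A B ε (n₀ + N * p) (k₀ + K * p) 1 =
      blockWeight A B ε p n₀ N (fun _ => 1) K * laurent A B 0 N K 1 + stripSum A B ε p n₀ N K * cTop A B 0 N K := by
  rw [blockWeight, stripSum, Finset.sum_mul, Finset.sum_mul, ← Finset.sum_add_distrib]
  exact Finset.sum_congr rfl fun k₀ _ => by rw [cell_depth_one_eq A B ε n₀ hK k₀, one_mul]

omit [Fact p.Prime] in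
/-- The leading coefficient is the sum of the depth-one cells: `x_{A−1}(n) = Σ_{k ≤ n} laurent … k 1` (`1 ≤ A`). -/
theorem xCoeff_pred_eq {A : ℕ} (hA : 1 ≤ A) (B ε n : ℕ) :
    xCoeff A B ε n (A - 1) = ∑ k ∈ range (n + 1), laurent A B ε n k 1 := by
  rw [xCoeff]
  exact Finset.sum_congr rfl fun k _ => by rw [cell, show A - (A - 1) = 1 by omega]

/-! ## The assembly -/

section assembly

variable (hp2 : p ≠ 2) {A B n₀ N L : ℕ} (hA : Even A) (hB : 1 ≤ B) (hAB : 2 * B ≤ A) (hn₀ : n₀ < p)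
  (hN : N < p ^ (L + 1))
include hp2 hA hB hAB hn₀ hN

/-- **THE HOLE PART at depth one**: `v(Σ_{hole k} p^{L+1}·c_{k,A−1}(n)) ≤ exp(−(A+L))` for the row `n = n₀ + Np` of the
kernel `ε = 1` — hole cells against the row `N − 1` (`BrickLevelReductionInf.hole_cell_le`), the hole weight of `g ≡ 1`
through H^∞ (`BrickHoleWeight`, `BrickPropositionHInf.propositionH_inf`), the exact-centre hole cell by `p ∣ C(n,k)`. -/
theorem hole_part_le :
    Rat.padicValuation p ((p : ℚ) ^ (L + 1) * ∑ k₀ ∈ Ico (n₀ + 1) p, ∑ K ∈ range N,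
      laurent A B 1 (n₀ + N * p) (k₀ + K * p) 1) ≤ exp (-((A : ℤ) + L)) := by
  have hp : p.Prime := Fact.out
  simp only [Finset.mul_sum]
  have hpQ : (p : ℚ) ≠ 0 := by exact_mod_cast hp.ne_zero
  have hpA : (p : ℚ) ^ A ≠ 0 := pow_ne_zero _ hpQ
  have hpv : Rat.padicValuation p (p : ℚ) = exp (-1 : ℤ) := Rat.padicValuation_self p
  rcases N with _ | m
  · simp only [Finset.range_zero, Finset.sum_empty, Finset.sum_const_zero, map_zero]; exact _root_.zero_le
  have hm : m < p ^ (L + 1) := by omega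
  have hn : n₀ + (m + 1) * p < p ^ (L + 1 + 1) := row_lt (L := L) hn₀ hN
  set n := n₀ + (m + 1) * p with hn_def
  -- the hole weight of the constant weight and its main term
  set G : ℕ → ℚ := holeWeight A B 1 p n₀ m (fun _ => 1) with hG
  set γ : ℕ → ℚ := fun K => G K / (p : ℚ) ^ A with hγ
  have hGγ : ∀ K, G K = (p : ℚ) ^ A * γ K := fun K => by rw [hγ]; simp only; rw [mul_div_cancel₀ _ hpA]
  have hγI : ∀ K, K ≤ m → Rat.padicValuation p (γ K) ≤ 1 := fun K hK => by
    have h := padicValuation_div_pow_le (p := p) A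
      (holeWeight_le hp2 hA hAB hn₀ (ε := 1) (g := fun _ : ℕ => (1 : ℚ)) (fun k _ => by rw [map_one]) hK)
    rw [neg_add_cancel, exp_zero] at h
    simpa only [hγ, hG] using h
  have hγS : ∀ K, K ≤ m → Rat.padicValuation p (γ (m - K) + γ K) ≤ exp (-(L : ℤ)) := fun K hK => by
    have h := padicValuation_div_pow_le (p := p) A
      (holeWeight_reflect_add_le hp2 hA hAB (ε := 1) le_rfl hn₀ (L := L) (g := fun _ : ℕ => (1 : ℚ))
        (fun k _ => by simp) hK)
    have h' : Rat.padicValuation p ((G (m - K) + G K) / (p : ℚ) ^ A) ≤ exp (-(L : ℤ)) := by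
      rw [hG]; exact h.trans (exp_le_exp.2 (by omega))
    simpa only [hγ, add_div] using h'
  have hγD : ∀ e K K', 1 ≤ e → e ≤ L → K ≤ m → K' ≤ m → (p : ℤ) ^ e ∣ (K : ℤ) - K' →
      Rat.padicValuation p (γ K' - γ K) ≤ exp (-(e : ℤ)) := fun e K K' he heL hK hK' hdvd => by
    have h := padicValuation_div_pow_le (p := p) A
      (holeWeight_local hp2 hA hAB (ε := 1) hn₀ (L := L) (g := fun _ : ℕ => (1 : ℚ)) (fun k _ => by rw [map_one])
        (fun e k k' _ _ _ _ _ => by simp) he heL hK hK' hdvd)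
    have h' : Rat.padicValuation p ((G K' - G K) / (p : ℚ) ^ A) ≤ exp (-(e : ℤ)) := by
      rw [hG]; exact h.trans (exp_le_exp.2 (by omega))
    simpa only [hγ, sub_div] using h'
  obtain ⟨Hs, -⟩ := propositionH_inf hp2 hA hB hAB L m hm γ hγI hγS hγD
  have hmain : Rat.padicValuation p (∑ K ∈ range (m + 1), G K * ((p : ℚ) ^ L * laurent A B 0 m K 1)) ≤
      exp (-((A : ℤ) + L)) := by
    have h := Hs (A - 1)
    simp only [cell, show A - (A - 1) = 1 by omega, mul_one] at h
    rw [show ∑ K ∈ range (m + 1), G K * ((p : ℚ) ^ L * laurent A B 0 m K 1) =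
        (p : ℚ) ^ A * ∑ K ∈ range (m + 1), γ K * ((p : ℚ) ^ L * laurent A B 0 m K 1) by
          rw [Finset.mul_sum]; exact Finset.sum_congr rfl fun K _ => by rw [hGγ K]; ring, map_mul, map_pow, hpv,
      ← exp_nsmul, nsmul_eq_mul, mul_neg_one]
    calc _ ≤ exp (-(A : ℤ)) * exp (-(L : ℤ)) := mul_le_mul' le_rfl h
      _ = _ := by rw [← exp_add, neg_add]
  -- the hole cells minus their main terms, cell by cell
  have hdiff : Rat.padicValuation p (∑ k₀ ∈ Ico (n₀ + 1) p, ∑ K ∈ range (m + 1),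
      (p : ℚ) ^ (L + 1) * laurent A B 1 n (k₀ + K * p) 1 -
      ∑ K ∈ range (m + 1), G K * ((p : ℚ) ^ L * laurent A B 0 m K 1)) ≤ exp (-((A : ℤ) + L)) := by
    have hrw : ∑ K ∈ range (m + 1), G K * ((p : ℚ) ^ L * laurent A B 0 m K 1) =
        ∑ k₀ ∈ Ico (n₀ + 1) p, ∑ K ∈ range (m + 1),
          (1 : ℚ) * (cTop A B 1 (n₀ + (m + 1) * p) (k₀ + K * p) / cTop A B 0 m K) *
            ((p : ℚ) ^ (L * 1) * laurent A B 0 m K 1) := by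
      simp only [hG, holeWeight, Finset.sum_mul, mul_one]
      rw [Finset.sum_comm (s := range (m + 1)) (t := Ico (n₀ + 1) p)]
    rw [hrw, ← Finset.sum_sub_distrib]
    refine Valuation.map_sum_le _ fun k₀ hk₀ => ?_
    rw [← Finset.sum_sub_distrib]
    refine Valuation.map_sum_le _ fun K hK => ?_
    have hk₀' := mem_Ico.1 hk₀
    have hK' : K ≤ m := by have := mem_range.1 hK; omega
    have hkn : k₀ + K * p ≤ n := by rw [hn_def]; nlinarith
    by_cases hc : 2 * (k₀ + K * p) ≠ n₀ + (m + 1) * p ∨ (1 : ℕ) = 0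
    · have h := hole_cell_le hp2 hAB (ε := 1) le_rfl hn₀ hm hK' hk₀'.1 hk₀'.2 hc (g := 1) (by rw [map_one]) 1
      simp only [mul_one, one_mul] at h ⊢
      exact h
    · -- the exact-centre hole cell: `λ = 0`, `c_{k,A−1}(n) = c̃_{k,A}(n)`, and `p ∣ C(n,k)` (Lucas, hole digit)
      have hcen : 2 * (k₀ + K * p) = n := by rw [hn_def]; by_contra h; exact hc (Or.inl h)
      rw [← hn_def, cTop_one_centre A B hcen, zero_div, mul_zero, zero_mul, sub_zero, map_mul, map_pow, hpv,
        ← exp_nsmul, nsmul_eq_mul, mul_neg_one, (laurent_centre A B hcen 0).1, laurent_zero hAB 0 hkn]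
      have hchoose : Rat.padicValuation p ((n.choose (k₀ + K * p) : ℕ) : ℚ) ≤ exp (-1 : ℤ) := by
        have h1 : 1 ≤ padicValNat p (n.choose (k₀ + K * p)) := by
          refine one_le_padicValNat_choose_of_mod_lt hkn ?_
          rw [hn_def, Nat.add_mul_mod_self_right, Nat.mod_eq_of_lt hn₀, Nat.add_mul_mod_self_right,
            Nat.mod_eq_of_lt hk₀'.2]
          exact hk₀'.1
        exact_mod_cast padicValuation_natCast_le_exp_neg (Nat.choose_pos hkn).ne' h1
      have htop : Rat.padicValuation p (cTop A B 0 n (k₀ + K * p)) ≤ exp (-(A : ℤ)) := by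
        rw [padicValuation_cTop_eq, pow_zero, one_mul, exp_neg_natCast]
        calc _ ≤ Rat.padicValuation p ((n.choose (k₀ + K * p) : ℕ) : ℚ) ^ A * 1 := mul_le_mul' le_rfl
              (pow_le_one' (mul_le_one' (padicValuation_natCast_le_one _) (padicValuation_natCast_le_one _)) _)
          _ ≤ exp (-1 : ℤ) ^ A := by rw [mul_one]; exact pow_le_pow_left' hchoose A
      calc _ ≤ exp (-((L : ℤ) + 1)) * exp (-(A : ℤ)) := mul_le_mul' (by push_cast; exact le_rfl) htop
        _ ≤ _ := by rw [← exp_add, exp_le_exp]; omega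
  have h := Valuation.map_add_le _ hdiff hmain
  rwa [sub_add_cancel] at h

variable
  (hV : ∀ K, K ≤ N → Rat.padicValuation p (stripSum A B 1 p n₀ N K - (p : ℚ) * xLead A B n₀) ≤ exp (-2 : ℤ))
  (hW : ∀ K K' e : ℕ, K ≤ N → K' ≤ N → (p : ℤ) ^ e ∣ (K : ℤ) - K' →
    Rat.padicValuation p (blockWeight A B 1 p n₀ N (fun _ => 1) K' - blockWeight A B 1 p n₀ N (fun _ => 1) K +
      ((K' : ℚ) - K) * ((p : ℚ) * xLead A B n₀)) ≤ exp (-((e : ℤ) + 2)))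

include hW in
/-- **THE `W`-PART**: with `D(K) = W(K) − p·x(n₀)·(N/2 − K)`, `v(Σ_{K ≤ N} D(K)·p^L·c̃_{K,A−1}(N)) ≤ exp(−(L+2))` —
`D/p²` is admissible for the row `N` at level `L` and H^∞ applies. -/
theorem wPart_le :
    Rat.padicValuation p (∑ K ∈ range (N + 1),
      (blockWeight A B 1 p n₀ N (fun _ => 1) K - (p : ℚ) * xLead A B n₀ * ((N : ℚ) / 2 - K)) *
        ((p : ℚ) ^ L * laurent A B 0 N K 1)) ≤ exp (-((L : ℤ) + 2)) := by
  have hp : p.Prime := Fact.out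
  have hpQ : (p : ℚ) ≠ 0 := by exact_mod_cast hp.ne_zero
  have hp2Q : (p : ℚ) ^ 2 ≠ 0 := pow_ne_zero _ hpQ
  have hpv : Rat.padicValuation p (p : ℚ) = exp (-1 : ℤ) := Rat.padicValuation_self p
  set W : ℕ → ℚ := blockWeight A B 1 p n₀ N (fun _ => 1) with hWdef
  set D : ℕ → ℚ := fun K => W K - (p : ℚ) * xLead A B n₀ * ((N : ℚ) / 2 - K) with hD
  set g : ℕ → ℚ := fun K => D K / (p : ℚ) ^ 2 with hg
  have hDg : ∀ K, D K = (p : ℚ) ^ 2 * g K := fun K => by rw [hg]; simp only; rw [mul_div_cancel₀ _ hp2Q]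
  -- the exact antisymmetry of `W` (every level) and the algebra of `D`
  have hgS1 : ∀ M : ℕ, ∀ k, k ≤ n₀ + N * p → Rat.padicValuation p
      ((fun _ : ℕ => (1 : ℚ)) (n₀ + N * p - k) + (-1) ^ 1 * (fun _ : ℕ => (1 : ℚ)) k) ≤ exp (-((M : ℤ) + 1)) :=
    fun M k _ => by rw [pow_one, neg_one_mul, add_neg_cancel, map_zero]; exact _root_.zero_le
  have hWS : ∀ M : ℕ, ∀ K, K ≤ N → Rat.padicValuation p (W (N - K) + W K) ≤ exp (-((M : ℤ) + 1)) :=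
    fun M K hK => blockWeight_reflect_add_le hp2 (B := B) hA (ε := 1) le_rfl hn₀ (L := M) (hgS1 M) hK
  have hDadd : ∀ K, K ≤ N → D (N - K) + D K = W (N - K) + W K := fun K hK => by
    rw [hD]; simp only; push_cast [hK]; ring
  have hDsub : ∀ K K', D K' - D K = W K' - W K + ((K' : ℚ) - K) * ((p : ℚ) * xLead A B n₀) :=
    fun K K' => by rw [hD]; simp only; ring
  have hDI : ∀ K, K ≤ N → Rat.padicValuation p (D K) ≤ exp (-2 : ℤ) := fun K hK => by
    have h1 : Rat.padicValuation p (D (N - K) - D K) ≤ exp (-2 : ℤ) := by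
      rw [hDsub K (N - K)]
      have h := hW K (N - K) 0 hK (Nat.sub_le _ _) (by rw [pow_zero]; exact one_dvd _)
      rwa [Nat.cast_zero, zero_add] at h
    have h2 : Rat.padicValuation p (D (N - K) + D K) ≤ exp (-2 : ℤ) := by
      rw [hDadd K hK]
      exact (hWS 1 K hK).trans (le_of_eq (by norm_num))
    have h3 : Rat.padicValuation p (2 * D K) ≤ exp (-2 : ℤ) := by
      rw [show 2 * D K = (D (N - K) + D K) - (D (N - K) - D K) by ring]
      exact (Valuation.map_sub _ _ _).trans (max_le h2 h1)
    rwa [map_mul, padicValuation_two hp2, one_mul] at h3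
  -- `g = D/p²` is admissible for `N` at level `L`
  have hgI : ∀ K, K ≤ N → Rat.padicValuation p (g K) ≤ 1 := fun K hK => by
    have h := padicValuation_div_pow_le (p := p) 2 (hDI K hK)
    rwa [show (-2 : ℤ) + (2 : ℕ) = 0 by norm_num, exp_zero] at h
  have hgS : ∀ K, K ≤ N → Rat.padicValuation p (g (N - K) + g K) ≤ exp (-(L : ℤ)) := fun K hK => by
    rw [hg]; simp only; rw [← add_div, hDadd K hK]
    have h := padicValuation_div_pow_le (p := p) 2 (hWS (L + 1) K hK)
    rwa [show -(((L + 1 : ℕ) : ℤ) + 1) + (2 : ℕ) = -(L : ℤ) by push_cast; ring] at h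
  have hgD : ∀ e K K', 1 ≤ e → e ≤ L → K ≤ N → K' ≤ N → (p : ℤ) ^ e ∣ (K : ℤ) - K' →
      Rat.padicValuation p (g K' - g K) ≤ exp (-(e : ℤ)) := fun e K K' _ _ hK hK' hdvd => by
    rw [hg]; simp only; rw [← sub_div, hDsub K K']
    have h := padicValuation_div_pow_le (p := p) 2 (hW K K' e hK hK' hdvd)
    rwa [show -((e : ℤ) + 2) + (2 : ℕ) = -(e : ℤ) by push_cast; ring] at h
  obtain ⟨Hs, -⟩ := propositionH_inf hp2 hA hB hAB L N hN g hgI hgS hgD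
  have h := Hs (A - 1)
  simp only [cell, show A - (A - 1) = 1 by omega, mul_one] at h
  rw [show ∑ K ∈ range (N + 1), D K * ((p : ℚ) ^ L * laurent A B 0 N K 1) =
      (p : ℚ) ^ 2 * ∑ K ∈ range (N + 1), g K * ((p : ℚ) ^ L * laurent A B 0 N K 1) by
        rw [Finset.mul_sum]; exact Finset.sum_congr rfl fun K _ => by rw [hDg K]; ring, map_mul, map_pow, hpv,
    ← exp_nsmul, nsmul_eq_mul, mul_neg_one]
  calc _ ≤ exp (-((2 : ℕ) : ℤ)) * exp (-(L : ℤ)) := mul_le_mul' le_rfl h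
    _ = _ := by rw [← exp_add]; congr 1; push_cast; ring

omit hA hB hAB hn₀ hN in
include hV in
/-- **THE `V`-PART**: `v(Σ_{K ≤ N} (V(K) − p·x(n₀))·p^L·c̃_{K,A}(N)) ≤ exp(−(L+2))` (termwise from (V): the top
cells are `p`-integral). -/
theorem vPart_le :
    Rat.padicValuation p (∑ K ∈ range (N + 1),
      (stripSum A B 1 p n₀ N K - (p : ℚ) * xLead A B n₀) * ((p : ℚ) ^ L * cTop A B 0 N K)) ≤ exp (-((L : ℤ) + 2)) := by
  have hpv : Rat.padicValuation p (p : ℚ) = exp (-1 : ℤ) := Rat.padicValuation_self p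
  refine Valuation.map_sum_le _ fun K hK => ?_
  have hK' : K ≤ N := by have := mem_range.1 hK; omega
  rw [map_mul, map_mul, map_pow, hpv, ← exp_nsmul, nsmul_eq_mul, mul_neg_one]
  calc _ ≤ exp (-2 : ℤ) * (exp (-(L : ℤ)) * 1) :=
      mul_le_mul' (hV K hK') (mul_le_mul' le_rfl (padicValuation_cTop_le_one hp2 A B 0 N K))
    _ = _ := by rw [mul_one, ← exp_add]; congr 1; ring

include hV hW in
/-- **THE ° PART against the target**: `v(Σ_{° cells} p^{L+1}c_{k,A−1}(n) − p·x(n₀)·Σ_{K ≤ N} p^L·c^{(1)}_{K,A−1}(N))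
≤ exp(−(L+2))` — the depth-one identity block by block, `c^{(1)}_{K,A−1}(N) = c̃_{K,A}(N) + (N/2 − K)c̃_{K,A−1}(N)`,
then `wPart_le` + `vPart_le`. -/
theorem circPart_le :
    Rat.padicValuation p ((p : ℚ) ^ (L + 1) * ∑ k₀ ∈ range (n₀ + 1), ∑ K ∈ range (N + 1),
        laurent A B 1 (n₀ + N * p) (k₀ + K * p) 1 -
      (p : ℚ) ^ (L + 1) * (xLead A B n₀ * ∑ K ∈ range (N + 1), laurent A B 1 N K 1)) ≤ exp (-((L : ℤ) + 2)) := by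
  have hcirc : (p : ℚ) ^ (L + 1) * ∑ k₀ ∈ range (n₀ + 1), ∑ K ∈ range (N + 1),
      laurent A B 1 (n₀ + N * p) (k₀ + K * p) 1 =
      ∑ K ∈ range (N + 1), (p : ℚ) ^ L * (blockWeight A B 1 p n₀ N (fun _ => 1) K * laurent A B 0 N K 1 +
        stripSum A B 1 p n₀ N K * cTop A B 0 N K) := by
    rw [Finset.sum_comm, Finset.mul_sum]
    refine Finset.sum_congr rfl fun K hK => ?_
    have hK' : K ≤ N := by have := mem_range.1 hK; omega
    rw [← block_depth_one_eq A B 1 n₀ hK', Finset.mul_sum, Finset.mul_sum]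
    exact Finset.sum_congr rfl fun k₀ _ => by ring
  have htarget : (p : ℚ) ^ (L + 1) * (xLead A B n₀ * ∑ K ∈ range (N + 1), laurent A B 1 N K 1) =
      ∑ K ∈ range (N + 1), (p : ℚ) ^ L * ((p : ℚ) * xLead A B n₀ * ((N : ℚ) / 2 - K) * laurent A B 0 N K 1 +
        (p : ℚ) * xLead A B n₀ * cTop A B 0 N K) := by
    rw [Finset.mul_sum, Finset.mul_sum]
    refine Finset.sum_congr rfl fun K hK => ?_
    have hK' : K ≤ N := by have := mem_range.1 hK; omega
    rw [show (1 : ℕ) = 0 + 1 from rfl, laurent_succ_succ A B 0 N K 0, laurent_zero hAB 0 hK']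
    ring
  rw [hcirc, htarget, ← Finset.sum_sub_distrib,
    show ∑ K ∈ range (N + 1), ((p : ℚ) ^ L * (blockWeight A B 1 p n₀ N (fun _ => 1) K * laurent A B 0 N K 1 +
        stripSum A B 1 p n₀ N K * cTop A B 0 N K) -
      (p : ℚ) ^ L * ((p : ℚ) * xLead A B n₀ * ((N : ℚ) / 2 - K) * laurent A B 0 N K 1 + (p : ℚ) * xLead A B n₀ * cTop A B 0 N K)) =
      ∑ K ∈ range (N + 1), (blockWeight A B 1 p n₀ N (fun _ => 1) K - (p : ℚ) * xLead A B n₀ * ((N : ℚ) / 2 - K)) *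
        ((p : ℚ) ^ L * laurent A B 0 N K 1) +
      ∑ K ∈ range (N + 1), (stripSum A B 1 p n₀ N K - (p : ℚ) * xLead A B n₀) * ((p : ℚ) ^ L * cTop A B 0 N K) by
      rw [← Finset.sum_add_distrib]; exact Finset.sum_congr rfl fun K _ => by ring]
  exact Valuation.map_add_le _ (wPart_le hp2 hA hB hAB hn₀ hN hW) (vPart_le hp2 hV)

include hV hW in
/-- **LUCAS FROM THE BLOCK LAWS.** For an odd prime `p`, `A` even, `1 ≤ B`, `2B ≤ A`, `n₀ < p`, `N < p^{L+1}` and the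
leading coefficient `x(n) = x_{A−1}(n)` (`xLead`) of the very-well-poised brick kernel `(A,B,1)`: if the strip sums
satisfy (V) `v(V(K) − p·x(n₀)) ≤ exp(−2)` (`K ≤ N`) and the ° block weights of the constant weight satisfy
(W) `v(W(K') − W(K) + (K' − K)·p·x(n₀)) ≤ exp(−(e+2))` whenever `p^e ∣ K − K'` (`K, K' ≤ N`), then
**`v(x(n₀ + Np) − x(n₀)·x(N)) ≤ exp(−1)`**: `x_{A−1}(n₀ + Np) ≡ x_{A−1}(n₀)·x_{A−1}(N) (mod p)`. -/
theorem lucas_of_blockLaws :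
    Rat.padicValuation p (xLead A B (n₀ + N * p) - xLead A B n₀ * xLead A B N) ≤ exp (-1 : ℤ) := by
  have hp : p.Prime := Fact.out
  have hpQ : (p : ℚ) ≠ 0 := by exact_mod_cast hp.ne_zero
  have hpL : (p : ℚ) ^ (L + 1) ≠ 0 := pow_ne_zero _ hpQ
  have hA1 : 1 ≤ A := by omega
  -- `p^{L+1}·(x(n) − x(n₀)x(N)) = (° part − target) + hole part`
  have hsplit : (p : ℚ) ^ (L + 1) * (xLead A B (n₀ + N * p) - xLead A B n₀ * xLead A B N) =
      ((p : ℚ) ^ (L + 1) * ∑ k₀ ∈ range (n₀ + 1), ∑ K ∈ range (N + 1), laurent A B 1 (n₀ + N * p) (k₀ + K * p) 1 -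
        (p : ℚ) ^ (L + 1) * (xLead A B n₀ * ∑ K ∈ range (N + 1), laurent A B 1 N K 1)) +
      (p : ℚ) ^ (L + 1) * ∑ k₀ ∈ Ico (n₀ + 1) p, ∑ K ∈ range N, laurent A B 1 (n₀ + N * p) (k₀ + K * p) 1 := by
    unfold xLead
    rw [xCoeff_pred_eq hA1, xCoeff_pred_eq hA1 B 1 N, sum_range_digit_split (p := p) _ hn₀ N]
    ring
  have hval : Rat.padicValuation p ((p : ℚ) ^ (L + 1) * (xLead A B (n₀ + N * p) - xLead A B n₀ * xLead A B N)) ≤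
      exp (-((L : ℤ) + 2)) := by
    rw [hsplit]
    refine Valuation.map_add_le _ (circPart_le hp2 hA hB hAB hn₀ hN hV hW)
      ((hole_part_le hp2 hA hB hAB hn₀ hN).trans (exp_le_exp.2 (by omega)))
  have h := padicValuation_div_pow_le (p := p) (L + 1) hval
  rwa [mul_div_cancel_left₀ _ hpL, show -((L : ℤ) + 2) + ((L + 1 : ℕ) : ℤ) = -1 by push_cast; ring] at h

end assembly

end

end Summit.KontsevichZagierPeriods.Zeta5Search.BrickLucasAssembly
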